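import Literature.Algebra.Homology.RankTwoLatticeCohomologyCharacters
import Literature.Algebra.Homology.GroupCohomologyClassEqZero
import Literature.Algebra.Homology.GroupCohomologySemilinear
import HarnessLib

/-!
# Product cocycles `θ₁ ∪ ⋯ ∪ θₙ` of additive characters and their torus equivariance

Topic `Algebra/Homology`; namespace `Literature.Algebra.Homology`.  Mathlib + the vocabulary of
`RankTwoLatticeCohomologyCharacters` (`trivRep`, `pairScalar`, `pairMapₛ`, `precompHom`),
`GroupCohomologyClassEqZero` and `GroupCohomologySemilinear` (`iCocycles_injective`); definitions with
bodies and theorems.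

For a group `G`, a field `k` with the trivial action and additive characters
`θ₁, …, θₙ : G → k`, the inhomogeneous `n`-cochain

  `(θ₁ ∪ ⋯ ∪ θₙ)(g₁, …, gₙ) = θ₁(g₁) θ₂(g₂) ⋯ θₙ(gₙ)`  (`prodCochain`)

is an `n`-COCYCLE (`d_prodCochain`: the iterated cup product of `1`-cocycles; the boundary
telescopes), with class `prodClass θ ∈ Hⁿ(G, k)`.  Under the scaled pair map `Φ_{c,a} = Hⁿ(c, a)` of
an endomorphism `c : G →* G`,

  `Φ_{c,a} [θ₁ ∪ ⋯ ∪ θₙ] = a · [(θ₁ ∘ c) ∪ ⋯ ∪ (θₙ ∘ c)]`  (`pairMapₛ_prodClass`),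

so that for common EIGEN-COORDINATES `θᵢ ∘ c_x = eᵢ(x) θᵢ` the classes `[θ_{φ(1)} ∪ ⋯ ∪ θ_{φ(n)}]`
are simultaneous eigenvectors of the `Φ_{c_x, a_x}` with the algebraic characters
`x ↦ a(x) ∏ᵢ e_{φ(i)}(x)` (`pairMapₛ_prodClass_of_eigen`); and `prodCochain` is multilinear in `θ`
(`prodCochain_sum_smul`, `prodClass_sum_smul`).  This is the cochain-level part of the computation
of the torus weights on `H•(ℤ^d, k) = Λ•(k^d)` [Brown1982CohomologyGroups, V §6] used for the
cohomology of the unipotent arithmetic groups of `GL₂` over a number field of degree `d`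
[Harder1987, §2, (2.4)–(2.7)].

## References

* K. S. Brown, *Cohomology of Groups*, GTM 87 (1982), V §3 (cup products), V §6
  [Brown1982CohomologyGroups].
* G. Harder, *Eisenstein cohomology of arithmetic groups. The case GL₂*, Invent. Math. 89 (1987), §2
  [Harder1987].
-/

noncomputable section

open CategoryTheory CategoryTheory.Limits groupCohomology Literature.LinearAlgebra

universe u

namespace Literature.Algebra.Homology

variable {k G : Type u} [Field k] [Group G]

/-! ### The product cochain and its boundary -/

/-- **The product cochain `(θ₁ ∪ ⋯ ∪ θₙ)(g) = ∏ᵢ θᵢ(gᵢ)`** of additive characters `θᵢ : G → k`.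
[cite: Brown1982CohomologyGroups, V §3] -/
def prodCochain {n : ℕ} (θ : Fin n → (Additive G →+ k)) : (Fin n → G) → k :=
  fun g => ∏ i, θ i (Additive.ofMul (g i))

/-- Unfolding `prodCochain`. [folklore] -/
theorem prodCochain_apply {n : ℕ} (θ : Fin n → (Additive G →+ k)) (g : Fin n → G) :
    prodCochain θ g = ∏ i, θ i (Additive.ofMul (g i)) :=
  rfl

/-- The telescoping terms `Bⱼ(g) = ∏_{i<j} θᵢ(gᵢ) · ∏_{i≥j} θᵢ(gᵢ₊₁)` of the boundary of a product
cochain (`g : Gⁿ⁺¹`, `0 ≤ j ≤ n`). [folklore] -/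
def prodAux {n : ℕ} (θ : Fin n → (Additive G →+ k)) (g : Fin (n + 1) → G) (j : ℕ) : k :=
  ∏ i : Fin n, if (i : ℕ) < j then θ i (Additive.ofMul (g (Fin.castSucc i))) else θ i (Additive.ofMul (g i.succ))

/-- `B₀(g) = (θ₁ ∪ ⋯ ∪ θₙ)(g₁, …, gₙ)` (first face). [folklore] -/
theorem prodCochain_tail {n : ℕ} (θ : Fin n → (Additive G →+ k)) (g : Fin (n + 1) → G) :
    prodCochain θ (fun i => g i.succ) = prodAux θ g 0 := by
  simp [prodCochain, prodAux]

/-- `Bₙ(g) = (θ₁ ∪ ⋯ ∪ θₙ)(g₀, …, gₙ₋₁)` (last face). [folklore] -/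
theorem prodCochain_contractNth_last {n : ℕ} (θ : Fin n → (Additive G →+ k)) (g : Fin (n + 1) → G) :
    prodCochain θ ((Fin.last n).contractNth (· * ·) g) = prodAux θ g n := by
  unfold prodCochain prodAux
  refine Finset.prod_congr rfl fun i _ => ?_
  rw [Fin.contractNth_apply_of_lt _ _ _ _ (by simp), if_pos i.2]

/-- The inner faces: `(θ₁ ∪ ⋯ ∪ θₙ)(…, gⱼ gⱼ₊₁, …) = Bⱼ(g) + Bⱼ₊₁(g)` for `j < n`. [folklore] -/
theorem prodCochain_contractNth_of_lt {n : ℕ} (θ : Fin n → (Additive G →+ k)) (g : Fin (n + 1) → G)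
    (j : Fin (n + 1)) (hj : (j : ℕ) < n) :
    prodCochain θ (j.contractNth (· * ·) g) = prodAux θ g j + prodAux θ g (j + 1) := by
  classical
  unfold prodCochain prodAux
  set j' : Fin n := ⟨j, hj⟩ with hj'
  have hjj' : (j' : ℕ) = j := rfl
  rw [← Finset.mul_prod_erase Finset.univ _ (Finset.mem_univ j'),
    ← Finset.mul_prod_erase Finset.univ (fun i : Fin n => if (i : ℕ) < (j : ℕ) then θ i (Additive.ofMul (g (Fin.castSucc i)))
      else θ i (Additive.ofMul (g i.succ))) (Finset.mem_univ j'),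
    ← Finset.mul_prod_erase Finset.univ (fun i : Fin n => if (i : ℕ) < (j : ℕ) + 1 then θ i (Additive.ofMul (g (Fin.castSucc i)))
      else θ i (Additive.ofMul (g i.succ))) (Finset.mem_univ j')]
  -- the factors off `j'` agree
  have hrest : ∀ i ∈ Finset.univ.erase j',
      θ i (Additive.ofMul (j.contractNth (· * ·) g i)) =
        (if (i : ℕ) < (j : ℕ) then θ i (Additive.ofMul (g (Fin.castSucc i))) else θ i (Additive.ofMul (g i.succ))) := by
    intro i hi
    have hij : i ≠ j' := Finset.ne_of_mem_erase hi
    have hij' : (i : ℕ) ≠ (j : ℕ) := fun h => hij (Fin.ext (h.trans hjj'.symm))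
    rcases lt_or_gt_of_ne hij' with hlt | hgt
    · rw [Fin.contractNth_apply_of_lt _ _ _ _ hlt, if_pos hlt]
    · rw [Fin.contractNth_apply_of_gt _ _ _ _ hgt, if_neg (not_lt.2 hgt.le)]
  have hrest' : ∀ i ∈ Finset.univ.erase j',
      (if (i : ℕ) < (j : ℕ) + 1 then θ i (Additive.ofMul (g (Fin.castSucc i))) else θ i (Additive.ofMul (g i.succ))) =
        (if (i : ℕ) < (j : ℕ) then θ i (Additive.ofMul (g (Fin.castSucc i))) else θ i (Additive.ofMul (g i.succ))) := by
    intro i hi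
    have hij : i ≠ j' := Finset.ne_of_mem_erase hi
    have hij' : (i : ℕ) ≠ (j : ℕ) := fun h => hij (Fin.ext (h.trans hjj'.symm))
    rcases lt_or_gt_of_ne hij' with hlt | hgt
    · rw [if_pos hlt, if_pos (Nat.lt_succ_of_lt hlt)]
    · rw [if_neg (not_lt.2 hgt.le), if_neg (by omega)]
  rw [Finset.prod_congr rfl hrest, Finset.prod_congr rfl hrest']
  -- the factor at `j'`
  rw [Fin.contractNth_apply_of_eq _ _ _ _ hjj', if_neg (lt_irrefl _), if_pos (Nat.lt_succ_self _), ofMul_mul,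
    map_add]
  ring

/-- **`θ₁ ∪ ⋯ ∪ θₙ` is a cocycle**: `d(θ₁ ∪ ⋯ ∪ θₙ) = B₀ + ∑_{j<n} (−1)^{j+1} (Bⱼ + Bⱼ₊₁) + (−1)ⁿ⁺¹ Bₙ = 0`.
[cite: Brown1982CohomologyGroups, V §3] -/
theorem d_prodCochain {n : ℕ} (θ : Fin n → (Additive G →+ k)) :
    inhomogeneousCochains.d (trivRep k G) n (prodCochain θ) = 0 := by
  funext g
  rw [inhomogeneousCochains.d_hom_apply, Fin.sum_univ_castSucc]
  change prodCochain θ (fun i => g i.succ) + _ = 0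
  rw [prodCochain_tail, prodCochain_contractNth_last]
  have hsum : ∑ j : Fin n, (-1 : k) ^ ((Fin.castSucc j : ℕ) + 1) • prodCochain θ ((Fin.castSucc j).contractNth (· * ·) g) =
      ∑ j ∈ Finset.range n, ((-1 : k) ^ (j + 1) * prodAux θ g (j + 1) - (-1 : k) ^ j * prodAux θ g j) := by
    rw [← Fin.sum_univ_eq_sum_range (fun j => (-1 : k) ^ (j + 1) * prodAux θ g (j + 1) - (-1 : k) ^ j * prodAux θ g j)]
    refine Finset.sum_congr rfl fun j _ => ?_
    rw [prodCochain_contractNth_of_lt θ g (Fin.castSucc j) (by simp), Fin.val_castSucc, smul_eq_mul,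
      pow_succ]
    ring
  have htel : ∑ j ∈ Finset.range n, ((-1 : k) ^ (j + 1) * prodAux θ g (j + 1) - (-1 : k) ^ j * prodAux θ g j) =
      (-1 : k) ^ n * prodAux θ g n - (-1 : k) ^ 0 * prodAux θ g 0 :=
    Finset.sum_range_sub (fun j => (-1 : k) ^ j * prodAux θ g j) n
  rw [hsum, htel, Fin.val_last, smul_eq_mul, pow_succ, pow_zero, one_mul]
  ring

/-! ### The class and its equivariance -/

/-- **The class `[θ₁ ∪ ⋯ ∪ θₙ] ∈ Hⁿ(G, k)`.** [cite: Brown1982CohomologyGroups, V §3] -/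
def prodClass {n : ℕ} (θ : Fin n → (Additive G →+ k)) : groupCohomology (trivRep k G) n :=
  π (trivRep k G) n (cocyclesMk (prodCochain θ) (d_prodCochain θ))

/-- The cocycle underlying `prodClass`. [folklore] -/
abbrev prodCocycle {n : ℕ} (θ : Fin n → (Additive G →+ k)) : cocycles (trivRep k G) n :=
  cocyclesMk (prodCochain θ) (d_prodCochain θ)

/-- `prodClass θ = π (prodCocycle θ)`. [folklore] -/
theorem prodClass_eq {n : ℕ} (θ : Fin n → (Additive G →+ k)) :
    prodClass θ = π (trivRep k G) n (prodCocycle θ) :=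
  rfl

/-- The pair map on cochains: `(cochainsMap c (pairScalar c a)) f = a · f ∘ (c ∘ ·)`. [folklore] -/
theorem cochainsMap_pairScalar_apply (c : G →* G) (a : k) (n : ℕ) (f : (Fin n → G) → k) (g : Fin n → G) :
    (cochainsMap c (pairScalar (k := k) c a)).f n f g = a * f (c ∘ g) := by
  rw [cochainsMap_f]
  rfl

/-- `(θ ∘ c)`-products are `θ`-products at `c ∘ g`. [folklore] -/
theorem prodCochain_precompHom {n : ℕ} (c : G →* G) (θ : Fin n → (Additive G →+ k)) (g : Fin n → G) :
    prodCochain (fun i => precompHom c (θ i)) g = prodCochain θ (c ∘ g) := by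
  simp [prodCochain]

/-- **Equivariance**: `Φ_{c,a} [θ₁ ∪ ⋯ ∪ θₙ] = a · [(θ₁ ∘ c) ∪ ⋯ ∪ (θₙ ∘ c)]`.
[cite: Brown1982CohomologyGroups, V §3] -/
theorem pairMapₛ_prodClass {n : ℕ} (c : G →* G) (a : k) (θ : Fin n → (Additive G →+ k)) :
    pairMapₛ c a n (prodClass θ) = a • prodClass (fun i => precompHom c (θ i)) := by
  rw [prodClass_eq, prodClass_eq, pairMapₛ, groupCohomology.π_map_apply, ← map_smul]
  congr 1
  apply iCocycles_injective
  rw [map_smul]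
  change ((cocyclesMap c (pairScalar c a) n) ≫ iCocycles (trivRep k G) n) (prodCocycle θ) = _
  rw [HomologicalComplex.cyclesMap_i]
  change (cochainsMap c (pairScalar (k := k) c a)).f n (iCocycles (trivRep k G) n (prodCocycle θ)) =
    a • iCocycles (trivRep k G) n (prodCocycle fun i => precompHom c (θ i))
  rw [iCocycles_mk, iCocycles_mk]
  funext g
  rw [cochainsMap_pairScalar_apply, Pi.smul_apply, smul_eq_mul, prodCochain_precompHom]

/-- **Eigen-coordinates give simultaneous eigenvectors**: if `θᵢ ∘ c = eᵢ · θᵢ` for all `i` then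
`Φ_{c,a} [θ₁ ∪ ⋯ ∪ θₙ] = (a ∏ᵢ eᵢ) · [θ₁ ∪ ⋯ ∪ θₙ]`. [cite: Harder1987, §2, (2.4)–(2.7)] -/
theorem pairMapₛ_prodClass_of_eigen {n : ℕ} (c : G →* G) (a : k) (θ : Fin n → (Additive G →+ k))
    (e : Fin n → k) (he : ∀ i, precompHom c (θ i) = e i • θ i) :
    pairMapₛ c a n (prodClass θ) = (a * ∏ i, e i) • prodClass θ := by
  rw [pairMapₛ_prodClass, mul_smul]
  congr 1
  have hcochain : prodCochain (fun i => precompHom c (θ i)) = (∏ i, e i) • prodCochain θ := by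
    funext g
    rw [Pi.smul_apply, smul_eq_mul, prodCochain_apply, prodCochain_apply, ← Finset.prod_mul_distrib]
    refine Finset.prod_congr rfl fun i _ => ?_
    rw [he i]
    rfl
  rw [prodClass_eq, prodClass_eq, ← map_smul]
  congr 1
  apply iCocycles_injective
  rw [map_smul, iCocycles_mk, iCocycles_mk, hcochain]

/-! ### Multilinearity -/

/-- **Multilinearity of the product cochain**: expanding `θ'ᵢ = ∑_τ N i τ · θ τ` gives
`θ'₁ ∪ ⋯ ∪ θ'ₙ = ∑_{φ : [n] → ι} (∏ᵢ N i φ(i)) · θ_{φ(1)} ∪ ⋯ ∪ θ_{φ(n)}`. [folklore] -/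
theorem prodCochain_sum_smul {n : ℕ} {ι : Type*} [Fintype ι] [DecidableEq ι] (θ : ι → (Additive G →+ k))
    (N : Fin n → ι → k) :
    prodCochain (fun i => ∑ τ, N i τ • θ τ) = ∑ φ : Fin n → ι, (∏ i, N i (φ i)) • prodCochain (fun i => θ (φ i)) := by
  funext g
  rw [prodCochain_apply, Finset.sum_apply]
  have h1 : ∀ i : Fin n, (∑ τ, N i τ • θ τ) (Additive.ofMul (g i)) = ∑ τ, N i τ * θ τ (Additive.ofMul (g i)) := by
    intro i
    rw [AddMonoidHom.finsetSum_apply]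
    rfl
  simp_rw [h1]
  rw [Finset.prod_univ_sum]
  simp only [Fintype.piFinset_univ]
  refine Finset.sum_congr rfl fun φ _ => ?_
  rw [Pi.smul_apply, smul_eq_mul, prodCochain_apply, ← Finset.prod_mul_distrib]

/-- The same at the level of classes. [folklore] -/
theorem prodClass_sum_smul {n : ℕ} {ι : Type*} [Fintype ι] [DecidableEq ι] (θ : ι → (Additive G →+ k))
    (N : Fin n → ι → k) :
    prodClass (fun i => ∑ τ, N i τ • θ τ) = ∑ φ : Fin n → ι, (∏ i, N i (φ i)) • prodClass (fun i => θ (φ i)) := by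
  simp only [prodClass_eq]
  have hz : prodCocycle (fun i => ∑ τ, N i τ • θ τ) = ∑ φ : Fin n → ι, (∏ i, N i (φ i)) • prodCocycle (fun i => θ (φ i)) := by
    apply iCocycles_injective
    rw [map_sum, iCocycles_mk, prodCochain_sum_smul]
    refine Finset.sum_congr rfl fun φ _ => ?_
    rw [map_smul, iCocycles_mk]
  rw [hz, map_sum]
  exact Finset.sum_congr rfl fun φ _ => by rw [map_smul]

end Literature.Algebra.Homology

end
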